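import Mathlib

/-!
# Contain-weighted positive association of the cluster law is FALSE — a kernel-checked
four-vertex witness (blind cell PercRepro2, p2; proofs/P2-G14-PAIRSPLIT.md §8)

For Bernoulli bond percolation the open cluster `C_s` of a vertex `s` is positively associated
(Harris), and stays so conditionally on `s ↮ X` (van den Berg–Häggström–Kahn 2006, Thm 1.3).
The cell asked (P2-G14-PAIRSPLIT.md §5, statement (B★)) whether positive association survives
the CONTAIN weight `1[y ∈ C_s]`, with the unconditioned means:

  `E[ 1[y ∈ C_s] · (f(C_s) − E f) · (g(C_s) − E g) ] ≥ 0`   for all antitone `f, g`,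

equivalently `Cov(f, g | y ∈ C_s) ≥ −(E[f | y ∈ C_s] − E f)·(E[g | y ∈ C_s] − E g)`.  It does NOT:
on `K₄` minus the edge `{0, 1}` — edges `{0,2}, {0,3}, {1,2}, {1,3}, {2,3}` with weights
`1/2, 4/5, 1/2, 4/5, 9/10` — with `s = 3`, `y = 2`, `f = 1[1 ∉ C_s]`, `g = 1[0 ∉ C_s]`
(no conditioning, `X = ∅`):

  `P(y ∈ C_s) = 241/250`, `P(f) = P(g) = 53/500`, `P(y ∈ C_s, f) = P(y ∈ C_s, g) = 47/500`,
  `P(y ∈ C_s, f, g) = 9/1000`,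

  `E[1_Y (f − Ef)(g − Eg)] = 9/1000 + (53/500)²·(241/250) − 2·(53/500)·(47/500) = −6031/62500000 < 0`.

Everything is a finite sum over the `2^5` edge configurations with integer weights in units of
`10^{-3}` (`wt c = ∏_i (num_i if open else den_i − num_i)`, denominators `2·5·2·5·10 = 1000`); the
six masses are established by `decide +kernel` (standard axioms only) and the inequality follows
by `norm_num`.  Found by the cell's tail-weight standard (weights near `0/1`); at every weight
`1/2` the statement holds exhaustively on all connected graphs with `≤ 6` vertices and all
avoid-indicator pairs (P2-G14-PAIRSPLIT.md §8).
-/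

namespace Summit.Ventures.PercRepro2.ContainWeightedCounterexample

/-- An undirected edge `{u, v}` with weight `num / den`. -/
structure WEdge where
  u : Nat
  v : Nat
  num : Nat
  den : Nat

/-- The five edges of `K₄ − {0, 1}` with their weights. -/
def edge : Nat → WEdge
  | 0 => ⟨0, 2, 1, 2⟩    -- {0, 2}, 1/2
  | 1 => ⟨0, 3, 4, 5⟩    -- {0, 3}, 4/5
  | 2 => ⟨1, 2, 1, 2⟩    -- {1, 2}, 1/2
  | 3 => ⟨1, 3, 4, 5⟩    -- {1, 3}, 4/5
  | _ => ⟨2, 3, 9, 10⟩   -- {2, 3}, 9/10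

/-- The root `s = 3`. -/
def s : Nat := 3
/-- The contained vertex `y = 2`. -/
def y : Nat := 2

/-- Edge `i` is open in the configuration `c ∈ [0, 2^5)` iff bit `i` of `c` is set. -/
def isOpen (c i : Nat) : Bool := c.testBit i

/-- Product Bernoulli weight of the configuration `c` in units of `10^{-3}`:
`∏_i (num_i if open else den_i − num_i)`. -/
def wt (c : Nat) : Nat :=
  (List.range 5).foldl
    (fun acc i => acc * (if isOpen c i then (edge i).num else (edge i).den - (edge i).num)) 1

/-- Vertex sets are bitmasks over `0..3`; `mem S x` is `x ∈ S`. -/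
def mem (S x : Nat) : Bool := S.testBit x

/-- One expansion step of a vertex set along the open (undirected) edges. -/
def step (c S : Nat) : Nat :=
  (List.range 5).foldl (fun S i =>
    let e := edge i
    if isOpen c i then
      let S₁ := if mem S e.u then S ||| (1 <<< e.v) else S
      if mem S₁ e.v then S₁ ||| (1 <<< e.u) else S₁
    else S) S

/-- `n`-fold iteration of `step c`. -/
def iter (c : Nat) : Nat → Nat → Nat
  | 0, S => S
  | n + 1, S => iter c n (step c S)

/-- The open cluster `C_s` of the configuration `c` (four steps suffice on four vertices). -/
def cluster (c : Nat) : Nat := iter c 4 (1 <<< s)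

/-- `Y = {y ∈ C_s}`. -/
def Y (c : Nat) : Bool := mem (cluster c) y
/-- `f = 1[1 ∉ C_s]` — antitone in `C_s`. -/
def f (c : Nat) : Bool := !(mem (cluster c) 1)
/-- `g = 1[0 ∉ C_s]` — antitone in `C_s`. -/
def g (c : Nat) : Bool := !(mem (cluster c) 0)

/-- `10^3 · P(Y)`. -/
def massY : Nat := (List.range 32).foldl (fun a c => if Y c then a + wt c else a) 0
/-- `10^3 · P(f)`. -/
def massf : Nat := (List.range 32).foldl (fun a c => if f c then a + wt c else a) 0
/-- `10^3 · P(g)`. -/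
def massg : Nat := (List.range 32).foldl (fun a c => if g c then a + wt c else a) 0
/-- `10^3 · P(Y, f)`. -/
def massYf : Nat := (List.range 32).foldl (fun a c => if Y c && f c then a + wt c else a) 0
/-- `10^3 · P(Y, g)`. -/
def massYg : Nat := (List.range 32).foldl (fun a c => if Y c && g c then a + wt c else a) 0
/-- `10^3 · P(Y, f, g)`. -/
def massYfg : Nat :=
  (List.range 32).foldl (fun a c => if Y c && f c && g c then a + wt c else a) 0

/-- Total mass `10^3` (sanity: the weights sum to one). -/
theorem total_mass : (List.range 32).foldl (fun a c => a + wt c) 0 = 1000 := by decide +kernel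

/-- `10^3 · P(Y) = 964`. -/
theorem massY_eq : massY = 964 := by decide +kernel
/-- `10^3 · P(f) = 106`. -/
theorem massf_eq : massf = 106 := by decide +kernel
/-- `10^3 · P(g) = 106`. -/
theorem massg_eq : massg = 106 := by decide +kernel
/-- `10^3 · P(Y, f) = 94`. -/
theorem massYf_eq : massYf = 94 := by decide +kernel
/-- `10^3 · P(Y, g) = 94`. -/
theorem massYg_eq : massYg = 94 := by decide +kernel
/-- `10^3 · P(Y, f, g) = 9`. -/
theorem massYfg_eq : massYfg = 9 := by decide +kernel

/-- `P(y ∈ C_s) = 241/250`. -/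
theorem probY : (massY : ℚ) / 1000 = 241 / 250 := by rw [massY_eq]; norm_num

/-- The contain-weighted form `E[1_Y (f − Ef)(g − Eg)]` equals `−6031/62500000`. -/
theorem contain_weighted_value :
    (massYfg : ℚ) / 1000 + (massf / 1000) * (massg / 1000) * (massY / 1000)
        - (massf / 1000) * (massYg / 1000) - (massg / 1000) * (massYf / 1000) =
      -6031 / 62500000 := by
  rw [massY_eq, massf_eq, massg_eq, massYf_eq, massYg_eq, massYfg_eq]; norm_num

/-- **Contain-weighted positive association FAILS**: on `K₄ − {0,1}` with the weights above,
`E[1_Y f g] + E f · E g · P(Y) < E f · E[1_Y g] + E g · E[1_Y f]`, i.e.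
`E[1[y ∈ C_s] (f − Ef)(g − Eg)] < 0` for the antitone pair `f = 1[1 ∉ C_s]`, `g = 1[0 ∉ C_s]`. -/
theorem contain_weighted_pa_false :
    (massYfg : ℚ) / 1000 + (massf / 1000) * (massg / 1000) * (massY / 1000) <
      (massf / 1000) * (massYg / 1000) + (massg / 1000) * (massYf / 1000) := by
  rw [massY_eq, massf_eq, massg_eq, massYf_eq, massYg_eq, massYfg_eq]; norm_num

/-- The same witness in the conditional form: `Cov(f, g | Y) < −(E[f|Y] − Ef)(E[g|Y] − Eg)`
(the negative correlation created by conditioning on `y ∈ C_s` exceeds the product of the lifts). -/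
theorem conditional_form :
    (massYfg : ℚ) / massY - (massYf / massY) * (massYg / massY) <
      -((massYf / massY - massf / 1000) * (massYg / massY - massg / 1000)) := by
  rw [massY_eq, massf_eq, massg_eq, massYf_eq, massYg_eq, massYfg_eq]; norm_num

end Summit.Ventures.PercRepro2.ContainWeightedCounterexample
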